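import Mathlib
import Summits.MatrixMultiplication.MatrixMultiplication.Theorems.FidelityWitnessesDiagonalPowerDecayBlockSelfSimilarity
import Literature.Computability.AlgebraicComplexity.AlderStrassen
import Literature.Computability.AlgebraicComplexity.AlderStrassenProofs

/-!
# Block self-similarity, border form: uniform capture bounds at budget `n²` are BORDER-rank lower bounds

Crux `FidelityWitnesses.DiagonalPowerDecay` (stmt-MatrixMultiplication-14053), lead c4, `--supports`; sequel to
`…BlockSelfSimilarity.lean` (p120930).  There: `R(⟨m,m,m⟩) ≤ K·m² ⟹ φ(K·m) ≥ 1/K²` via the block-diagonal tensor `♯D`.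
Here the same dictionary for the BORDER rank `R̲ = algBorderRank` (Bläser Def. 6.1 = BCS (15.19)), the currency of the
route (`FidelityThesis` is a superquadratic border-rank bound in witness form):

* the block-diagonal placement `t ↦ Σᵢ padᵢ t` (`K` zero-padded copies of an `m × m`-format tensor on the diagonal blocks of the
  `K·m` format, written in restriction normal form) is CONTINUOUS, multiplies rank by at most `K`, and sends `⟨m,m,m⟩` to `♯D`
  (`bssb_blockSum_matMul`); a capture bound on rank-`≤ r` tensors extends to their Euclidean closure (`bssb_capture_le_of_mem_closure`);
  by Alder–Strassen over `ℂ` (`mem_closure_setOf_tensorRank_le_iff` with the tree's PROVED `alder_…_holds`) that closure is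
  `{R̲ ≤ r}`;
* hence **`φ(K·m) ≤ c` with `c·K² < 1` forces `R̲(⟨m,m,m⟩) > K·m²`** (`algBorderRank_matMul_gt_of_capture_le`), and the
  qualitative decay `φ(n) → 0` forces **`R̲(⟨m,m,m⟩)/m² → ∞`** (`superlinear_algBorderRank_of_qualitativeDecay`); the crux a fortiori.

Calibration against print: `R̲(⟨m,m,m⟩) ≥ 2m² − ⌈log₂ m⌉ − 1` (Landsberg–Michałek 2018) is the frontier, so a uniform capture
constant `c < 1/4` at the formats `n = 2m` would already be NEW (`R̲(⟨m,m,m⟩) > 2m²`); the only n-uniform constant proved is `5/6`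
(`koszulWitness`, lead c3), Koszul flattenings saturate near `1/2`, and linear rank methods cannot certify below `1/6`.
Mathlib + the landed `bss_*` / `vrl_*` lemmas + Literature (`TensorRestrictsTo`, `tensorRank_sum_le`, Alder–Strassen); no definitions.
-/

set_option linter.dupNamespace false

namespace Summit.MatrixMultiplication.MatrixMultiplication.Theorems.DiagonalPowerDecay

open scoped BigOperators
open Filter
open Literature.Computability.AlgebraicComplexity
open Summit.MatrixMultiplication.MatrixMultiplication.Theses.FidelityWitnesses (DiagonalPowerDecay)

/-! ## Padding onto block `i` in restriction normal form -/

/-- **Padding is a restriction** (by its very normal form `Σ_{abc} [E a = x][E b = y][E c = z]·t_{abc}`), hence rank-monotone: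
`R(padᵢ t) ≤ R(t)`. [folklore] -/
theorem bssb_tensorRank_pad_le {K m : ℕ} (i : Fin K) (t : (Fin m × Fin m) → (Fin m × Fin m) → (Fin m × Fin m) → ℂ) :
    tensorRank (fun x y z : Fin (K * m) × Fin (K * m) =>
      ∑ a : Fin m × Fin m, ∑ b : Fin m × Fin m, ∑ c : Fin m × Fin m,
        (if (finProdFinEquiv (i, a.1), finProdFinEquiv (i, a.2)) = x then (1 : ℂ) else 0) *
        (if (finProdFinEquiv (i, b.1), finProdFinEquiv (i, b.2)) = y then (1 : ℂ) else 0) *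
        (if (finProdFinEquiv (i, c.1), finProdFinEquiv (i, c.2)) = z then (1 : ℂ) else 0) * t a b c) ≤
      tensorRank t :=
  TensorRestrictsTo.tensorRank_le ⟨fun x a => if (finProdFinEquiv (i, a.1), finProdFinEquiv (i, a.2)) = x then 1 else 0,
    fun y b => if (finProdFinEquiv (i, b.1), finProdFinEquiv (i, b.2)) = y then 1 else 0,
    fun z c => if (finProdFinEquiv (i, c.1), finProdFinEquiv (i, c.2)) = z then 1 else 0, fun _ _ _ => rfl⟩

/-- **Rank of the block-diagonal placement**: `R(Σᵢ padᵢ t) ≤ K·R(t)` (subadditivity + `bssb_tensorRank_pad_le`). [folklore] -/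
theorem bssb_tensorRank_blockSum_le {K m : ℕ} (t : (Fin m × Fin m) → (Fin m × Fin m) → (Fin m × Fin m) → ℂ) :
    tensorRank (∑ i : Fin K, fun x y z : Fin (K * m) × Fin (K * m) =>
      ∑ a : Fin m × Fin m, ∑ b : Fin m × Fin m, ∑ c : Fin m × Fin m,
        (if (finProdFinEquiv (i, a.1), finProdFinEquiv (i, a.2)) = x then (1 : ℂ) else 0) *
        (if (finProdFinEquiv (i, b.1), finProdFinEquiv (i, b.2)) = y then (1 : ℂ) else 0) *
        (if (finProdFinEquiv (i, c.1), finProdFinEquiv (i, c.2)) = z then (1 : ℂ) else 0) * t a b c) ≤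
      K * tensorRank t := by
  refine ((tensorRank_sum_le _ _).trans (Finset.sum_le_sum fun i _ => bssb_tensorRank_pad_le i t)).trans ?_
  simp

/-- **The block-diagonal placement is continuous** (a finite sum of coordinate functionals times constants). [folklore] -/
theorem bssb_continuous_blockSum {K m : ℕ} :
    Continuous fun t : (Fin m × Fin m) → (Fin m × Fin m) → (Fin m × Fin m) → ℂ =>
      ∑ i : Fin K, fun x y z : Fin (K * m) × Fin (K * m) =>
        ∑ a : Fin m × Fin m, ∑ b : Fin m × Fin m, ∑ c : Fin m × Fin m,
          (if (finProdFinEquiv (i, a.1), finProdFinEquiv (i, a.2)) = x then (1 : ℂ) else 0) *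
          (if (finProdFinEquiv (i, b.1), finProdFinEquiv (i, b.2)) = y then (1 : ℂ) else 0) *
          (if (finProdFinEquiv (i, c.1), finProdFinEquiv (i, c.2)) = z then (1 : ℂ) else 0) * t a b c := by
  refine continuous_finsetSum _ fun i _ => ?_
  refine continuous_pi fun x => continuous_pi fun y => continuous_pi fun z => ?_
  refine continuous_finsetSum _ fun a _ => continuous_finsetSum _ fun b _ =>
    continuous_finsetSum _ fun c _ => ?_
  exact continuous_const.mul ((continuous_apply c).comp ((continuous_apply b).comp (continuous_apply a)))

/-- **Padding `⟨m,m,m⟩` onto block `i` gives `♯Dᵢ`** (the `i`-th diagonal block of matrix multiplication; same computation as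
`bss_block_restrictsTo`, here with the normal form on the left so that it can be summed over `i`). [folklore] -/
theorem bssb_pad_matMul {K m : ℕ} (i : Fin K) :
    (fun x y z : Fin (K * m) × Fin (K * m) =>
      ∑ a : Fin m × Fin m, ∑ b : Fin m × Fin m, ∑ c : Fin m × Fin m,
        (if (finProdFinEquiv (i, a.1), finProdFinEquiv (i, a.2)) = x then (1 : ℂ) else 0) *
        (if (finProdFinEquiv (i, b.1), finProdFinEquiv (i, b.2)) = y then (1 : ℂ) else 0) *
        (if (finProdFinEquiv (i, c.1), finProdFinEquiv (i, c.2)) = z then (1 : ℂ) else 0) *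
          matMulTensor ℂ m m m a b c) =
    fun a b c : Fin (K * m) × Fin (K * m) =>
      Matrix.diagonal (fun v : Fin (K * m) × Fin (K * m) × Fin (K * m) =>
        if (finProdFinEquiv.symm v.1).1 = i ∧ (finProdFinEquiv.symm v.2.1).1 = i ∧
            (finProdFinEquiv.symm v.2.2).1 = i then (1 : ℂ) else 0)
        (a.1, b.2, c.2) (b.1, c.1, a.2) := by
  classical
  funext x y z
  -- the embedding of index pairs of block `i`
  set E : Fin m × Fin m → Fin (K * m) × Fin (K * m) :=
    fun p => (finProdFinEquiv (i, p.1), finProdFinEquiv (i, p.2)) with hE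
  have hEq : ∀ p q : Fin m × Fin m, E p = E q ↔ p = q := by
    intro p q
    simp only [hE, Prod.mk.injEq, EmbeddingLike.apply_eq_iff_eq, true_and]
    exact Iff.symm Prod.ext_iff
  have hEinj : Function.Injective E := fun p q h => (hEq p q).1 h
  change (∑ a : Fin m × Fin m, ∑ b : Fin m × Fin m, ∑ c : Fin m × Fin m,
      (if E a = x then (1 : ℂ) else 0) * (if E b = y then (1 : ℂ) else 0) *
      (if E c = z then (1 : ℂ) else 0) * matMulTensor ℂ m m m a b c) = _
  -- the left-hand side vanishes unless all three indices are in the image of `E`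
  have hLHS_off : ¬ ((∃ a, E a = x) ∧ (∃ b, E b = y) ∧ (∃ c, E c = z)) →
      (∑ a : Fin m × Fin m, ∑ b : Fin m × Fin m, ∑ c : Fin m × Fin m,
        (if E a = x then (1 : ℂ) else 0) * (if E b = y then (1 : ℂ) else 0) *
        (if E c = z then (1 : ℂ) else 0) * matMulTensor ℂ m m m a b c) = 0 := by
    intro hoff
    refine Finset.sum_eq_zero fun a _ => Finset.sum_eq_zero fun b _ =>
      Finset.sum_eq_zero fun c _ => ?_
    by_cases ha : E a = x
    · by_cases hb : E b = y
      · have hc : E c ≠ z := fun hc => hoff ⟨⟨a, ha⟩, ⟨b, hb⟩, ⟨c, hc⟩⟩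
        simp [hc]
      · simp [hb]
    · simp [ha]
  -- the right-hand side vanishes unless all three indices are in the image of `E`
  have hRHS_off : Matrix.diagonal (fun v : Fin (K * m) × Fin (K * m) × Fin (K * m) =>
      if (finProdFinEquiv.symm v.1).1 = i ∧ (finProdFinEquiv.symm v.2.1).1 = i ∧
        (finProdFinEquiv.symm v.2.2).1 = i then (1 : ℂ) else 0) (x.1, y.2, z.2) (y.1, z.1, x.2) ≠ 0 →
      (∃ a, E a = x) ∧ (∃ b, E b = y) ∧ (∃ c, E c = z) := by
    rw [Matrix.diagonal_apply]
    split_ifs with heq hblk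
    · intro _
      simp only [Prod.mk.injEq] at heq
      exact ⟨bss_exists_pair_of_blocks i x hblk.1 (by rw [← heq.2.2]; exact hblk.2.2),
        bss_exists_pair_of_blocks i y (by rw [← heq.1]; exact hblk.1) hblk.2.1,
        bss_exists_pair_of_blocks i z (by rw [← heq.2.1]; exact hblk.2.1) hblk.2.2⟩
    · simp
    · simp
  by_cases hall : (∃ a, E a = x) ∧ (∃ b, E b = y) ∧ (∃ c, E c = z)
  · -- on the image: both sides are `⟨m,m,m⟩_{a₀ b₀ c₀}`
    obtain ⟨⟨a₀, rfl⟩, ⟨b₀, rfl⟩, ⟨c₀, rfl⟩⟩ := hall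
    simp only [hEinj.eq_iff]
    rw [Finset.sum_eq_single a₀ (fun a _ ha => by simp [ha]) (by simp),
      Finset.sum_eq_single b₀ (fun b _ hb => by simp [hb]) (by simp),
      Finset.sum_eq_single c₀ (fun c _ hc => by simp [hc]) (by simp), Matrix.diagonal_apply]
    simp only [hE, Prod.mk.injEq, EmbeddingLike.apply_eq_iff_eq, true_and, bss_fst_symm_apply,
      and_self, if_true, matMulTensor, one_mul]
    by_cases h : a₀.1 = b₀.1 ∧ b₀.2 = c₀.1 ∧ a₀.2 = c₀.2
    · rw [if_pos h, if_pos ⟨h.1, h.2.1, h.2.2.symm⟩]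
    · rw [if_neg h, if_neg]
      rintro ⟨h1, h2, h3⟩
      exact h ⟨h1, h2, h3.symm⟩
  · rw [hLHS_off hall]
    symm
    by_contra hne
    exact hall (hRHS_off hne)

/-- **The block-diagonal placement of `⟨m,m,m⟩` is `♯D`**, the block-diagonal matrix multiplication tensor of
`…BlockSelfSimilarity.lean` (`bssb_pad_matMul` summed over the blocks, `bss_blockDiag_eq_sum`). [folklore] -/
theorem bssb_blockSum_matMul {K m : ℕ} :
    (∑ i : Fin K, fun x y z : Fin (K * m) × Fin (K * m) =>
      ∑ a : Fin m × Fin m, ∑ b : Fin m × Fin m, ∑ c : Fin m × Fin m,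
        (if (finProdFinEquiv (i, a.1), finProdFinEquiv (i, a.2)) = x then (1 : ℂ) else 0) *
        (if (finProdFinEquiv (i, b.1), finProdFinEquiv (i, b.2)) = y then (1 : ℂ) else 0) *
        (if (finProdFinEquiv (i, c.1), finProdFinEquiv (i, c.2)) = z then (1 : ℂ) else 0) *
          matMulTensor ℂ m m m a b c) =
    fun a b c : Fin (K * m) × Fin (K * m) =>
      Matrix.diagonal (fun v : Fin (K * m) × Fin (K * m) × Fin (K * m) =>
        if (finProdFinEquiv.symm v.1).1 = (finProdFinEquiv.symm v.2.1).1 ∧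
            (finProdFinEquiv.symm v.2.1).1 = (finProdFinEquiv.symm v.2.2).1 then (1 : ℂ) else 0)
        (a.1, b.2, c.2) (b.1, c.1, a.2) := by
  rw [bss_blockDiag_eq_sum]
  exact Finset.sum_congr rfl fun i _ => bssb_pad_matMul i

/-! ## Capture bounds pass to the Euclidean closure -/

/-- The overlap `S ↦ ⟨S, T⟩` is continuous. [folklore] -/
theorem bssb_continuous_overlap {n : ℕ} (T : (Fin n × Fin n) → (Fin n × Fin n) → (Fin n × Fin n) → ℂ) :
    Continuous fun S : (Fin n × Fin n) → (Fin n × Fin n) → (Fin n × Fin n) → ℂ =>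
      ∑ a, ∑ b, ∑ c, S a b c * T a b c := by
  refine continuous_finsetSum _ fun a _ => continuous_finsetSum _ fun b _ =>
    continuous_finsetSum _ fun c _ => ?_
  exact (show Continuous fun S : (Fin n × Fin n) → (Fin n × Fin n) → (Fin n × Fin n) → ℂ => S a b c by
    fun_prop).mul continuous_const

/-- The squared norm `S ↦ ‖S‖²` is continuous. [folklore] -/
theorem bssb_continuous_normSq {n : ℕ} :
    Continuous fun S : (Fin n × Fin n) → (Fin n × Fin n) → (Fin n × Fin n) → ℂ =>
      ∑ a, ∑ b, ∑ c, ‖S a b c‖ ^ 2 := by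
  refine continuous_finsetSum _ fun a _ => continuous_finsetSum _ fun b _ =>
    continuous_finsetSum _ fun c _ => ?_
  exact ((show Continuous fun S : (Fin n × Fin n) → (Fin n × Fin n) → (Fin n × Fin n) → ℂ => S a b c by
    fun_prop).norm).pow 2

/-- **A capture bound on rank-`≤ r` tensors holds on their Euclidean closure** (both sides are continuous in `S`; the
sub-level set is closed; `closure_minimal`). [folklore] -/
theorem bssb_capture_le_of_mem_closure {n r : ℕ} {c : ℝ}
    (hcap : ∀ S : (Fin n × Fin n) → (Fin n × Fin n) → (Fin n × Fin n) → ℂ, tensorRank S ≤ r →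
      ‖∑ a, ∑ b, ∑ c, S a b c * matMulTensor ℂ n n n a b c‖ ^ 2 ≤
        c * (n : ℝ) ^ 3 * ∑ a, ∑ b, ∑ c, ‖S a b c‖ ^ 2)
    {S : (Fin n × Fin n) → (Fin n × Fin n) → (Fin n × Fin n) → ℂ}
    (hS : S ∈ closure {S : (Fin n × Fin n) → (Fin n × Fin n) → (Fin n × Fin n) → ℂ | tensorRank S ≤ r}) :
    ‖∑ a, ∑ b, ∑ c, S a b c * matMulTensor ℂ n n n a b c‖ ^ 2 ≤
      c * (n : ℝ) ^ 3 * ∑ a, ∑ b, ∑ c, ‖S a b c‖ ^ 2 := by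
  have hclosed : IsClosed {S : (Fin n × Fin n) → (Fin n × Fin n) → (Fin n × Fin n) → ℂ |
      ‖∑ a, ∑ b, ∑ c, S a b c * matMulTensor ℂ n n n a b c‖ ^ 2 ≤
        c * (n : ℝ) ^ 3 * ∑ a, ∑ b, ∑ c, ‖S a b c‖ ^ 2} :=
    isClosed_le (((bssb_continuous_overlap _).norm).pow 2) (continuous_const.mul bssb_continuous_normSq)
  exact closure_minimal (fun S hS => hcap S hS) hclosed hS

/-! ## The dictionary, border form -/

/-- **A uniform capture bound at budget `n²` keeps `⟨m,m,m⟩` out of the closure of the rank-`≤ K·m²` tensors.**  If in the format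
`n = K·m` (`K, m ≥ 1`) every tensor of rank `≤ n²` has `|⟨S,T_n⟩|² ≤ c·n³·‖S‖²` with `c·K² < 1`, then `⟨m,m,m⟩` is not a limit of
tensors of rank `≤ K·m²`: otherwise its block-diagonal placement `♯D` would be a limit of tensors of rank `≤ n²` capturing
`n³/K² > c·n³`. [folklore] -/
theorem not_mem_closure_matMul_of_capture_le {K m : ℕ} {c : ℝ} (hm : 1 ≤ m) (hK : 1 ≤ K)
    (hc : c * (K : ℝ) ^ 2 < 1)
    (hcap : ∀ S : (Fin (K * m) × Fin (K * m)) → (Fin (K * m) × Fin (K * m)) → (Fin (K * m) × Fin (K * m)) → ℂ,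
      tensorRank S ≤ (K * m) ^ 2 →
        ‖∑ a, ∑ b, ∑ c, S a b c * matMulTensor ℂ (K * m) (K * m) (K * m) a b c‖ ^ 2 ≤
          c * ((K * m : ℕ) : ℝ) ^ 3 * ∑ a, ∑ b, ∑ c, ‖S a b c‖ ^ 2) :
    matMulTensor ℂ m m m ∉
      closure {S : (Fin m × Fin m) → (Fin m × Fin m) → (Fin m × Fin m) → ℂ | tensorRank S ≤ K * m ^ 2} := by
  intro hcl
  -- the block-diagonal placement of `⟨m,m,m⟩` is a limit of tensors of rank `≤ (K m)²`
  have hmaps : Set.MapsTo (fun t : (Fin m × Fin m) → (Fin m × Fin m) → (Fin m × Fin m) → ℂ =>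
      ∑ i : Fin K, fun x y z : Fin (K * m) × Fin (K * m) =>
        ∑ a : Fin m × Fin m, ∑ b : Fin m × Fin m, ∑ c : Fin m × Fin m,
          (if (finProdFinEquiv (i, a.1), finProdFinEquiv (i, a.2)) = x then (1 : ℂ) else 0) *
          (if (finProdFinEquiv (i, b.1), finProdFinEquiv (i, b.2)) = y then (1 : ℂ) else 0) *
          (if (finProdFinEquiv (i, c.1), finProdFinEquiv (i, c.2)) = z then (1 : ℂ) else 0) * t a b c)
      {S | tensorRank S ≤ K * m ^ 2}
      {S : (Fin (K * m) × Fin (K * m)) → (Fin (K * m) × Fin (K * m)) → (Fin (K * m) × Fin (K * m)) → ℂ |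
        tensorRank S ≤ (K * m) ^ 2} := by
    intro t ht
    simp only [Set.mem_setOf_eq] at ht ⊢
    calc _ ≤ K * tensorRank t := bssb_tensorRank_blockSum_le t
      _ ≤ K * (K * m ^ 2) := Nat.mul_le_mul_left _ ht
      _ = (K * m) ^ 2 := by ring
  have h1 := map_mem_closure bssb_continuous_blockSum hcl hmaps
  rw [bssb_blockSum_matMul] at h1
  have key := bssb_capture_le_of_mem_closure hcap h1
  rw [vrl_capture_eq_trace, bss_trace_blockDiag, vrl_normSq_eq, bss_frob_blockDiag, Complex.norm_natCast] at key
  push_cast at key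
  have hK0 : (0 : ℝ) < K := by exact_mod_cast hK
  have hm0 : (0 : ℝ) < m := by exact_mod_cast hm
  have e1 : ((K : ℝ) * (m : ℝ) ^ 3) ^ 2 = ((K : ℝ) ^ 2 * (m : ℝ) ^ 6) * 1 := by ring
  have e2 : c * ((K : ℝ) * (m : ℝ)) ^ 3 * ((K : ℝ) * (m : ℝ) ^ 3) =
      ((K : ℝ) ^ 2 * (m : ℝ) ^ 6) * (c * (K : ℝ) ^ 2) := by ring
  rw [e1, e2] at key
  have hpos : (0 : ℝ) < (K : ℝ) ^ 2 * (m : ℝ) ^ 6 := by positivity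
  have h2 : (1 : ℝ) ≤ c * (K : ℝ) ^ 2 := le_of_mul_le_mul_left key hpos
  linarith

/-- **Uniform capture bounds are BORDER-rank lower bounds.**  Under the hypotheses of `not_mem_closure_matMul_of_capture_le`,
`R̲(⟨m,m,m⟩) > K·m²` (Alder–Strassen over `ℂ`: the closure of the rank-`≤ r` tensors is `{R̲ ≤ r}`,
`mem_closure_setOf_tensorRank_le_iff` with the proved `alder_secantVariety_eq_setOf_algBorderRank_le_holds`).  Instance: a uniform
`φ(2m) ≤ c < 1/4` would give `R̲(⟨m,m,m⟩) > 2m²`, beyond the printed `2m² − ⌈log₂ m⌉ − 1`. [folklore] -/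
theorem algBorderRank_matMul_gt_of_capture_le {K m : ℕ} {c : ℝ} (hm : 1 ≤ m) (hK : 1 ≤ K)
    (hc : c * (K : ℝ) ^ 2 < 1)
    (hcap : ∀ S : (Fin (K * m) × Fin (K * m)) → (Fin (K * m) × Fin (K * m)) → (Fin (K * m) × Fin (K * m)) → ℂ,
      tensorRank S ≤ (K * m) ^ 2 →
        ‖∑ a, ∑ b, ∑ c, S a b c * matMulTensor ℂ (K * m) (K * m) (K * m) a b c‖ ^ 2 ≤
          c * ((K * m : ℕ) : ℝ) ^ 3 * ∑ a, ∑ b, ∑ c, ‖S a b c‖ ^ 2) :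
    K * m ^ 2 < algBorderRank (matMulTensor ℂ m m m) := by
  by_contra hle
  rw [not_lt] at hle
  exact not_mem_closure_matMul_of_capture_le hm hK hc hcap
    ((mem_closure_setOf_tensorRank_le_iff alder_secantVariety_eq_setOf_algBorderRank_le_holds _ _).2 hle)

/-- **Qualitative decay forces superlinear BORDER rank**: if the captured fraction at budget `n²` tends to zero then
`R̲(⟨m,m,m⟩)/m² → ∞` — for every `K`, eventually `R̲(⟨m,m,m⟩) > K·m²` (open; frontier `2m² − ⌈log₂ m⌉ − 1`,
Landsberg–Michałek 2018). [folklore] -/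
theorem superlinear_algBorderRank_of_qualitativeDecay
    (h : ∀ ε : ℝ, 0 < ε → ∃ N : ℕ, ∀ n : ℕ, N ≤ n →
      ∀ S : (Fin n × Fin n) → (Fin n × Fin n) → (Fin n × Fin n) → ℂ, tensorRank S ≤ n ^ 2 →
        ‖∑ a, ∑ b, ∑ c, S a b c * matMulTensor ℂ n n n a b c‖ ^ 2 ≤
          ε * (n : ℝ) ^ 3 * ∑ a, ∑ b, ∑ c, ‖S a b c‖ ^ 2) :
    ∀ K : ℕ, ∃ M : ℕ, ∀ m : ℕ, M ≤ m → K * m ^ 2 < algBorderRank (matMulTensor ℂ m m m) := by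
  suffices hK1 : ∀ K : ℕ, 1 ≤ K → ∃ M : ℕ, ∀ m : ℕ, M ≤ m →
      K * m ^ 2 < algBorderRank (matMulTensor ℂ m m m) by
    intro K
    obtain ⟨M, hM⟩ := hK1 (max K 1) (le_max_right _ _)
    exact ⟨M, fun m hm => lt_of_le_of_lt (Nat.mul_le_mul_right _ (le_max_left K 1)) (hM m hm)⟩
  intro K hK
  have hK0 : (0 : ℝ) < K := by exact_mod_cast hK
  obtain ⟨N, hN⟩ := h (1 / (2 * (K : ℝ) ^ 2)) (by positivity)
  refine ⟨max N 1, fun m hm => ?_⟩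
  have hm1 : 1 ≤ m := le_trans (le_max_right _ _) hm
  have hNm : N ≤ K * m := le_trans (le_trans (le_max_left _ _) hm) (Nat.le_mul_of_pos_left m hK)
  have hc : 1 / (2 * (K : ℝ) ^ 2) * (K : ℝ) ^ 2 < 1 := by
    rw [one_div, inv_mul_eq_div, div_lt_one (by positivity)]
    nlinarith
  exact algBorderRank_matMul_gt_of_capture_le hm1 hK hc (hN (K * m) hNm)

/-- **The crux forces superlinear border rank via its qualitative shadow** (`qualitativeDecay_of_diagonalPowerDecay` +
`superlinear_algBorderRank_of_qualitativeDecay`; the sharper power-scale consequence is the landed `dpdGlue_two_lt_omega`).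
[folklore] -/
theorem superlinear_algBorderRank_of_diagonalPowerDecay (hD : DiagonalPowerDecay) :
    ∀ K : ℕ, ∃ M : ℕ, ∀ m : ℕ, M ≤ m → K * m ^ 2 < algBorderRank (matMulTensor ℂ m m m) :=
  superlinear_algBorderRank_of_qualitativeDecay (qualitativeDecay_of_diagonalPowerDecay hD)

end Summit.MatrixMultiplication.MatrixMultiplication.Theorems.DiagonalPowerDecay
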